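import Summits.AnomalousDissipation.AnomalousDissipation.Theorems.BaireTransferRobustLoudUpgradeStubSteadyPersist
import Literature.Analysis.FluidPDE.SteadyNSLatticeLinearised
import Literature.Analysis.FunctionSpaces.TorusVectorParseval

/-!
# Stub `lsFamily_phaseFunctional` of the line `malkin-cone-group-orbits` (crux stmt-AnomalousDissipation-1144,
# companion lead c2, "Lyapunov–Schmidt crossing"): the PHASE FUNCTIONAL on the Fourier lattice

Registered part lemma (of the analytic stub `stub_lsFamily`), Pi-form:
`∀ v, IsSmooth v → ∃ φ : ℓ²(ℤ³; ℂ³) →L[ℝ] ℝ, ∀ x w, IsSmooth w → cf x = 𝓕(complexify ∘ w) → φ x = ∫ ⟪v, w⟫_ℝ`,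
where `cf x := (k ↦ ((|k|²)⁻¹ : ℂ)) • ⇑x` recovers the Fourier coefficients of the real field represented by the
lattice state `x` (`x k = |k|² û(k)`).

Content.  The Lyapunov–Schmidt reduction for steady Navier–Stokes on `T³` is run on the Fourier lattice
`ℓ²(ℤ³; ℂ³)`; the bordered implicit function theorem needs a *phase functional*: a continuous real-linear functional
on the lattice space whose value on the state vector of a smooth real field `w` is the `L²` pairing `∫ ⟪v, w⟫_ℝ`
with a fixed smooth real field `v` (Kielhöfer 2012, §I.2: the complement of the kernel is fixed by a bounded
projection, here the `L²`-pairing with `v`).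

Proof idea (folklore).  Put `V := 𝓕(complexify ∘ v)`, a rapidly decaying — in particular absolutely summable —
family (`IsSmooth.rapidDecay_mFourierCoeff`).  Define `φ x := ∑' k, Re ⟪V k, (cf x) k⟫_ℂ`.  Each term is bounded by
`‖V k‖ · |k|⁻² · ‖x k‖ ≤ ‖V k‖ · ‖x‖` (`|k|⁻² ≤ 1` on `ℤ³`, with Lean's `0⁻¹ = 0` at `k = 0`; `‖x k‖ ≤ ‖x‖` in `ℓ²`),
so the series converges absolutely with `|φ x| ≤ (∑ ‖V k‖) ‖x‖`; additivity and real homogeneity are termwise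
(`cf` is real-linear, the inner product is `ℂ`-linear in the second slot and `Re (a z) = a Re z` for real `a`), and
`LinearMap.mkContinuous` packages the bound.  If `cf x = 𝓕(complexify ∘ w)` then termwise
`Re ⟪V k, (cf x) k⟫ = Re ⟪𝓕(complexify ∘ v) k, 𝓕(complexify ∘ w) k⟫`, and Parseval's identity for real vector fields
on the torus (`Torus.hasSum_re_inner_mFourierCoeff_complexify`, Grafakos, Prop. 3.2.7) sums the series to
`∫ ⟪v, w⟫_ℝ`.

References.
* L. Grafakos, *Classical Fourier Analysis*, 3rd ed., GTM 249 (2014), Prop. 3.2.7 (Parseval on `T^n`).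
* H. Kielhöfer, *Bifurcation Theory. An Introduction with Applications to PDEs*, 2nd ed., Springer (2012), §I.2
  (the Lyapunov–Schmidt reduction).
-/

-- `Summit.<Summit>.<Problem>` is the tree's mandated summit-side namespace (CONVENTIONS §2); for this
-- single-conjunct summit the two coincide, so the duplicate is deliberate.
set_option linter.dupNamespace false

noncomputable section

open scoped BigOperators Topology ENNReal NNReal InnerProductSpace ComplexConjugate
open Filter Set Function TopologicalSpace MeasureTheory UnitAddTorus

namespace Summit.AnomalousDissipation.AnomalousDissipation.Theorems.RobustLoudUpgrade.LsFamily

open Literature.Analysis.FunctionSpaces Literature.Analysis.FunctionSpaces.Torus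
open Literature.Analysis.FunctionSpaces.EuclideanSpace
open Literature.Analysis.FluidPDE
open Literature.Analysis.FluidPDE.ScalarFourier
open Literature.Analysis.FluidPDE.SteadyLattice

/-! ## The terms of the phase series `Re ⟪V k, (cf x) k⟫` -/

/-- `(|k|²)⁻¹ ≤ 1` on `ℤ³`: it is `0` at `k = 0` (Lean's `0⁻¹ = 0`) and `|k|² ≥ 1` otherwise. [folklore] -/
private theorem inv_freqNormSq_le_one (k : Fin 3 → ℤ) : (freqNormSq k)⁻¹ ≤ 1 := by
  by_cases hk : k = 0
  · subst hk
    rw [freqNormSq_zero, inv_zero]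
    exact zero_le_one
  · exact inv_le_one_of_one_le₀ (one_le_freqNormSq' hk)

/-- Termwise bound of the phase series: `|Re ⟪V k, (cf x) k⟫| ≤ ‖V k‖ ‖x‖`. [folklore] -/
private theorem abs_term_le (V : (Fin 3 → ℤ) → EuclideanSpace ℂ (Fin 3))
    (x : lp (fun _ : Fin 3 → ℤ => EuclideanSpace ℂ (Fin 3)) 2) (k : Fin 3 → ℤ) :
    |(inner ℂ (V k) ((((fun mm : Fin 3 → ℤ => (((freqNormSq mm)⁻¹ : ℝ) : ℂ)) •
        ((x : (Fin 3 → ℤ) → EuclideanSpace ℂ (Fin 3)))) k))).re| ≤ ‖V k‖ * ‖x‖ := by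
  refine (Complex.abs_re_le_norm _).trans ((norm_inner_le_norm _ _).trans ?_)
  refine mul_le_mul_of_nonneg_left ?_ (norm_nonneg _)
  rw [norm_cf]
  calc (freqNormSq k)⁻¹ * ‖(x : (Fin 3 → ℤ) → EuclideanSpace ℂ (Fin 3)) k‖
      ≤ 1 * ‖x‖ :=
        mul_le_mul (inv_freqNormSq_le_one k) (l2_norm_apply_le x k) (norm_nonneg _) zero_le_one
    _ = ‖x‖ := one_mul _

/-- The phase series converges absolutely as soon as `∑ ‖V k‖ < ∞`. [folklore] -/
private theorem summable_term {V : (Fin 3 → ℤ) → EuclideanSpace ℂ (Fin 3)}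
    (hV : Summable fun k => ‖V k‖) (x : lp (fun _ : Fin 3 → ℤ => EuclideanSpace ℂ (Fin 3)) 2) :
    Summable fun k : Fin 3 → ℤ => (inner ℂ (V k) ((((fun mm : Fin 3 → ℤ => (((freqNormSq mm)⁻¹ : ℝ) : ℂ)) •
        ((x : (Fin 3 → ℤ) → EuclideanSpace ℂ (Fin 3)))) k))).re :=
  Summable.of_norm_bounded (hV.mul_right ‖x‖) fun k => by
    rw [Real.norm_eq_abs]
    exact abs_term_le V x k

/-- The sum of the phase series is bounded by `(∑ ‖V k‖) ‖x‖`. [folklore] -/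
private theorem norm_tsum_term_le {V : (Fin 3 → ℤ) → EuclideanSpace ℂ (Fin 3)}
    (hV : Summable fun k => ‖V k‖) (x : lp (fun _ : Fin 3 → ℤ => EuclideanSpace ℂ (Fin 3)) 2) :
    ‖∑' k : Fin 3 → ℤ, (inner ℂ (V k) ((((fun mm : Fin 3 → ℤ => (((freqNormSq mm)⁻¹ : ℝ) : ℂ)) •
        ((x : (Fin 3 → ℤ) → EuclideanSpace ℂ (Fin 3)))) k))).re‖ ≤ (∑' k, ‖V k‖) * ‖x‖ := by
  have h := tsum_of_norm_bounded (hV.mul_right ‖x‖).hasSum fun k => by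
    rw [Real.norm_eq_abs]
    exact abs_term_le V x k
  rwa [tsum_mul_right] at h

/-- Additivity of the terms in the lattice variable. [folklore] -/
private theorem term_add (V : (Fin 3 → ℤ) → EuclideanSpace ℂ (Fin 3))
    (x y : lp (fun _ : Fin 3 → ℤ => EuclideanSpace ℂ (Fin 3)) 2) (k : Fin 3 → ℤ) :
    (inner ℂ (V k) ((((fun mm : Fin 3 → ℤ => (((freqNormSq mm)⁻¹ : ℝ) : ℂ)) •
        (((x + y : lp (fun _ : Fin 3 → ℤ => EuclideanSpace ℂ (Fin 3)) 2) : (Fin 3 → ℤ) →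
          EuclideanSpace ℂ (Fin 3)))) k))).re =
      (inner ℂ (V k) ((((fun mm : Fin 3 → ℤ => (((freqNormSq mm)⁻¹ : ℝ) : ℂ)) •
        ((x : (Fin 3 → ℤ) → EuclideanSpace ℂ (Fin 3)))) k))).re +
      (inner ℂ (V k) ((((fun mm : Fin 3 → ℤ => (((freqNormSq mm)⁻¹ : ℝ) : ℂ)) •
        ((y : (Fin 3 → ℤ) → EuclideanSpace ℂ (Fin 3)))) k))).re := by
  rw [l2_coe_add, cf_add, Pi.add_apply, inner_add_right, Complex.add_re]

/-- Real homogeneity of the terms in the lattice variable. [folklore] -/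
private theorem term_smul (V : (Fin 3 → ℤ) → EuclideanSpace ℂ (Fin 3)) (a : ℝ)
    (x : lp (fun _ : Fin 3 → ℤ => EuclideanSpace ℂ (Fin 3)) 2) (k : Fin 3 → ℤ) :
    (inner ℂ (V k) ((((fun mm : Fin 3 → ℤ => (((freqNormSq mm)⁻¹ : ℝ) : ℂ)) •
        (((a • x : lp (fun _ : Fin 3 → ℤ => EuclideanSpace ℂ (Fin 3)) 2) : (Fin 3 → ℤ) →
          EuclideanSpace ℂ (Fin 3)))) k))).re =
      a * (inner ℂ (V k) ((((fun mm : Fin 3 → ℤ => (((freqNormSq mm)⁻¹ : ℝ) : ℂ)) •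
        ((x : (Fin 3 → ℤ) → EuclideanSpace ℂ (Fin 3)))) k))).re := by
  rw [l2_coe_smul, cf_real_smul, Pi.smul_apply, inner_smul_right, Complex.re_ofReal_mul]

/-! ## The phase functional -/

/-- **Phase functional on the Fourier lattice.**  For a fixed smooth real field `v` on `T³` there is a continuous
real-linear functional `φ` on `ℓ²(ℤ³; ℂ³)` such that `φ x = ∫ ⟪v, w⟫_ℝ` whenever the lattice state `x` represents the
smooth real field `w`, i.e. `(k ↦ (|k|²)⁻¹) • x = 𝓕(complexify ∘ w)`.  (Termwise `φ x = ∑ Re ⟪𝓕v(k), (cf x)(k)⟫`,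
bounded by `(∑ ‖𝓕v(k)‖) ‖x‖`; the identity is Parseval, Grafakos Prop. 3.2.7; the rôle of `φ` is the phase
condition of the Lyapunov–Schmidt reduction, Kielhöfer 2012 §I.2.) [folklore] -/
theorem lsFamily_phaseFunctional :
    ∀ (v : UnitAddTorus (Fin 3) → EuclideanSpace ℝ (Fin 3)), IsSmooth v →
      ∃ φ : (lp (fun _ : Fin 3 → ℤ => EuclideanSpace ℂ (Fin 3)) 2) →L[ℝ] ℝ,
        ∀ (x : lp (fun _ : Fin 3 → ℤ => EuclideanSpace ℂ (Fin 3)) 2)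
          (w : UnitAddTorus (Fin 3) → EuclideanSpace ℝ (Fin 3)), IsSmooth w →
          ((fun mm : Fin 3 → ℤ => (((freqNormSq mm)⁻¹ : ℝ) : ℂ)) •
              ((x : (Fin 3 → ℤ) → EuclideanSpace ℂ (Fin 3)))) = mFourierCoeff (complexify ∘ w) →
          φ x = ∫ y, inner ℝ (v y) (w y) := by
  intro v hv
  -- the Fourier coefficients of `v`: rapidly decaying, hence absolutely summable
  set V : (Fin 3 → ℤ) → EuclideanSpace ℂ (Fin 3) := mFourierCoeff (complexify ∘ v) with hVdef
  have hVs : Summable fun k => ‖V k‖ := (hv.complexify_comp.rapidDecay_mFourierCoeff).summable_norm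
  -- the real-linear map `x ↦ ∑' k, Re ⟪V k, (cf x) k⟫`
  let T : (lp (fun _ : Fin 3 → ℤ => EuclideanSpace ℂ (Fin 3)) 2) →ₗ[ℝ] ℝ :=
    { toFun := fun x => ∑' k : Fin 3 → ℤ, (inner ℂ (V k)
        ((((fun mm : Fin 3 → ℤ => (((freqNormSq mm)⁻¹ : ℝ) : ℂ)) •
          ((x : (Fin 3 → ℤ) → EuclideanSpace ℂ (Fin 3)))) k))).re
      map_add' := fun x y => by
        simp only [term_add V x y]
        exact (summable_term hVs x).tsum_add (summable_term hVs y)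
      map_smul' := fun a x => by
        simp only [term_smul V a x, RingHom.id_apply, smul_eq_mul]
        exact tsum_mul_left }
  refine ⟨T.mkContinuous (∑' k, ‖V k‖) fun x => norm_tsum_term_le hVs x, fun x w hw hx => ?_⟩
  rw [LinearMap.mkContinuous_apply]
  change ∑' k : Fin 3 → ℤ, (inner ℂ (V k) ((((fun mm : Fin 3 → ℤ => (((freqNormSq mm)⁻¹ : ℝ) : ℂ)) •
      ((x : (Fin 3 → ℤ) → EuclideanSpace ℂ (Fin 3)))) k))).re = ∫ y, inner ℝ (v y) (w y)
  rw [hx, hVdef]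
  exact (hasSum_re_inner_mFourierCoeff_complexify (hv.memLp 2) (hw.memLp 2)).tsum_eq

end Summit.AnomalousDissipation.AnomalousDissipation.Theorems.RobustLoudUpgrade.LsFamily

end
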